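import Mathlib.MeasureTheory.Constructions.Pi
import Mathlib.MeasureTheory.Measure.Lebesgue.Basic
import Mathlib.MeasureTheory.Measure.Prod
import Mathlib.MeasureTheory.Integral.Lebesgue.Map
import HarnessLib

/-!
# THE TIP CORE, LEADER-PAIR SPLIT: integrating out the transverse letters of the two leaders (measure plumbing for LEAD g100's `leaderLayer_ORIG`)
# (cell ym-idea-1; free-hands support of ⟨stmt-QuantumFields-24197⟩ `SwapVirialDeficit.SwapGluedStiffness`; LEAD g100 ruling (C2), 2026-09-01T02:31Z)

For an ARBITRARY (not necessarily measurable) base function `G : ℝ × ℝ → ℝ≥0∞` of the two axial letters `(x 0, y 0)` and measurable transverse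
weights `h₁, h₂ : (Fin 2 → ℝ) → ℝ≥0∞`:
* `lintegral_leaderPair_le_base` — `∫⁻ (x,y), G (x 0, y 0) · h₁ (x∘succ) · h₂ (y∘succ) ≤ ∫⁻ p, G p · ((∫⁻ h₁) · (∫⁻ h₂))` (all `volume`);
* `setLIntegral_leaderPair_le_base` — the twin with the outer integral restricted to `{(x,y) | (x 0, y 0) ∈ P ∧ Q (x,y)}` against `∫⁻ p in P, …`
  (`P` measurable, `Q` arbitrary).
Route: `piFinSuccAbove 0` on each factor (✓`volume_preserving_piFinSuccAbove`), the volume-preserving shuffle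
`(ℝ × ℝ²) × (ℝ × ℝ²) ≃ᵐ (ℝ × ℝ) × (ℝ² × ℝ²)` (assoc ∕ comm bricks), ✓`MeasurePreserving.lintegral_map_equiv` (no measurability of the integrand),
✓`lintegral_prod_le` (product ≤ iterated, no measurability), then ✓`lintegral_const_mul` + ✓`lintegral_prod_mul` on the measurable transverse factor.

HONEST LABEL: measure plumbing only, no model content; hLLm ∕ hCore ∕ ⟨24197⟩ ∕ ⟨24194⟩ OPEN; item of record ⟨24085⟩ aside ∕ untouched; the Yang–Mills mass gap is NOT proved;
no summit is proved by a line.  THEOREMS ONLY (0 `def`, 0 `sorry`), standard axioms, no instances.  Seat ym-line-fcl-p3 g49, `--supports stmt-QuantumFields-24197`.  References: [folklore].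
-/

set_option autoImplicit false

noncomputable section

open MeasureTheory
open scoped ENNReal

namespace Summit.QuantumFields.YangMills.Theorems.SwapVirialDeficit.SectorLaplace

set_option maxHeartbeats 800000 in
/-- ★ **Leader-pair split.** For any `G : ℝ × ℝ → ℝ≥0∞` (no measurability) and measurable `h₁ h₂ : (Fin 2 → ℝ) → ℝ≥0∞`:
`∫⁻ (x,y), G (x 0, y 0) · (h₁ (x∘succ) · h₂ (y∘succ)) ≤ ∫⁻ p, G p · ((∫⁻ u, h₁ u) · (∫⁻ v, h₂ v))`. [folklore] -/
theorem lintegral_leaderPair_le_base (G : ℝ × ℝ → ℝ≥0∞) {h₁ h₂ : (Fin 2 → ℝ) → ℝ≥0∞} (hh₁ : Measurable h₁) (hh₂ : Measurable h₂) :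
    ∫⁻ xy : (Fin 3 → ℝ) × (Fin 3 → ℝ), G (xy.1 0, xy.2 0) * (h₁ (fun i : Fin 2 => xy.1 i.succ) * h₂ (fun i : Fin 2 => xy.2 i.succ)) ≤
      ∫⁻ p : ℝ × ℝ, G p * ((∫⁻ u, h₁ u) * (∫⁻ v, h₂ v)) := by
  -- the axial ∕ transverse letters of one leader
  set e₀ : (Fin 3 → ℝ) ≃ᵐ ℝ × (Fin 2 → ℝ) := MeasurableEquiv.piFinSuccAbove (fun _ : Fin 3 => ℝ) 0 with he₀
  have he : MeasurePreserving e₀ volume volume := volume_preserving_piFinSuccAbove (fun _ : Fin 3 => ℝ) 0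
  have hΨ : MeasurePreserving (MeasurableEquiv.prodCongr e₀ e₀) volume volume := he.prod he
  -- the shuffle `(ℝ × W) × (ℝ × W) ≃ᵐ (ℝ × ℝ) × (W × W)`
  set s1 : (ℝ × (Fin 2 → ℝ)) × (ℝ × (Fin 2 → ℝ)) ≃ᵐ ℝ × ((Fin 2 → ℝ) × (ℝ × (Fin 2 → ℝ))) := MeasurableEquiv.prodAssoc with hs1
  set s2 : ℝ × ((Fin 2 → ℝ) × (ℝ × (Fin 2 → ℝ))) ≃ᵐ ℝ × (((Fin 2 → ℝ) × ℝ) × (Fin 2 → ℝ)) :=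
    MeasurableEquiv.prodCongr (MeasurableEquiv.refl ℝ) MeasurableEquiv.prodAssoc.symm with hs2
  set s3 : ℝ × (((Fin 2 → ℝ) × ℝ) × (Fin 2 → ℝ)) ≃ᵐ ℝ × ((ℝ × (Fin 2 → ℝ)) × (Fin 2 → ℝ)) :=
    MeasurableEquiv.prodCongr (MeasurableEquiv.refl ℝ) (MeasurableEquiv.prodCongr MeasurableEquiv.prodComm (MeasurableEquiv.refl (Fin 2 → ℝ))) with hs3
  set s4 : ℝ × ((ℝ × (Fin 2 → ℝ)) × (Fin 2 → ℝ)) ≃ᵐ ℝ × (ℝ × ((Fin 2 → ℝ) × (Fin 2 → ℝ))) :=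
    MeasurableEquiv.prodCongr (MeasurableEquiv.refl ℝ) MeasurableEquiv.prodAssoc with hs4
  set s5 : ℝ × (ℝ × ((Fin 2 → ℝ) × (Fin 2 → ℝ))) ≃ᵐ (ℝ × ℝ) × ((Fin 2 → ℝ) × (Fin 2 → ℝ)) := MeasurableEquiv.prodAssoc.symm with hs5
  have h1 : MeasurePreserving s1 volume volume := volume_preserving_prodAssoc
  have h2 : MeasurePreserving s2 volume volume := (MeasurePreserving.id volume).prod volume_preserving_prodAssoc.symm
  have h3 : MeasurePreserving s3 volume volume :=
    (MeasurePreserving.id volume).prod ((Measure.measurePreserving_swap (μ := (volume : Measure (Fin 2 → ℝ))) (ν := (volume : Measure ℝ))).prod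
      (MeasurePreserving.id volume))
  have h4 : MeasurePreserving s4 volume volume := (MeasurePreserving.id volume).prod volume_preserving_prodAssoc
  have h5 : MeasurePreserving s5 volume volume := volume_preserving_prodAssoc.symm
  set Ω : (Fin 3 → ℝ) × (Fin 3 → ℝ) ≃ᵐ (ℝ × ℝ) × ((Fin 2 → ℝ) × (Fin 2 → ℝ)) :=
    (MeasurableEquiv.prodCongr e₀ e₀).trans (s1.trans (s2.trans (s3.trans (s4.trans s5)))) with hΩ
  have hΩp : MeasurePreserving Ω volume volume := (h5.comp (h4.comp (h3.comp (h2.comp h1)))).comp hΨ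
  -- coordinates of the inverse
  have hc0 : ∀ (a : ℝ) (u : Fin 2 → ℝ), e₀.symm (a, u) 0 = a := fun a u => by
    simp [he₀, MeasurableEquiv.piFinSuccAbove, Fin.insertNthEquiv]
  have hcs : ∀ (a : ℝ) (u : Fin 2 → ℝ), (fun i : Fin 2 => e₀.symm (a, u) i.succ) = u := fun a u => by
    funext i
    fin_cases i <;> simp [he₀, MeasurableEquiv.piFinSuccAbove, Fin.insertNthEquiv]
    rfl
  have hΩs : ∀ q : (ℝ × ℝ) × ((Fin 2 → ℝ) × (Fin 2 → ℝ)), Ω.symm q = (e₀.symm (q.1.1, q.2.1), e₀.symm (q.1.2, q.2.2)) := fun q => rfl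
  -- change of variables (no measurability of the integrand needed)
  rw [MeasurePreserving.lintegral_map_equiv _ Ω.symm (hΩp.symm Ω)]
  have hpt : ∀ q : (ℝ × ℝ) × ((Fin 2 → ℝ) × (Fin 2 → ℝ)),
      G ((Ω.symm q).1 0, (Ω.symm q).2 0) * (h₁ (fun i : Fin 2 => (Ω.symm q).1 i.succ) * h₂ (fun i : Fin 2 => (Ω.symm q).2 i.succ)) =
        G q.1 * (h₁ q.2.1 * h₂ q.2.2) := by
    intro q
    rw [hΩs q]
    show G (e₀.symm (q.1.1, q.2.1) 0, e₀.symm (q.1.2, q.2.2) 0) *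
        (h₁ (fun i : Fin 2 => e₀.symm (q.1.1, q.2.1) i.succ) * h₂ (fun i : Fin 2 => e₀.symm (q.1.2, q.2.2) i.succ)) = _
    rw [hc0, hc0, hcs, hcs]
  simp_rw [hpt]
  -- product ≤ iterated, then the measurable transverse factor
  have hm : Measurable fun uv : (Fin 2 → ℝ) × (Fin 2 → ℝ) => h₁ uv.1 * h₂ uv.2 := (hh₁.comp measurable_fst).mul (hh₂.comp measurable_snd)
  calc ∫⁻ q : (ℝ × ℝ) × ((Fin 2 → ℝ) × (Fin 2 → ℝ)), G q.1 * (h₁ q.2.1 * h₂ q.2.2)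
      = ∫⁻ q, G q.1 * (h₁ q.2.1 * h₂ q.2.2) ∂((volume : Measure (ℝ × ℝ)).prod (volume : Measure ((Fin 2 → ℝ) × (Fin 2 → ℝ)))) := rfl
    _ ≤ ∫⁻ p : ℝ × ℝ, ∫⁻ uv : (Fin 2 → ℝ) × (Fin 2 → ℝ), G p * (h₁ uv.1 * h₂ uv.2) := lintegral_prod_le _
    _ = ∫⁻ p : ℝ × ℝ, G p * ∫⁻ uv : (Fin 2 → ℝ) × (Fin 2 → ℝ), h₁ uv.1 * h₂ uv.2 := by
        refine lintegral_congr fun p => ?_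
        rw [lintegral_const_mul _ hm]
    _ = ∫⁻ p : ℝ × ℝ, G p * ((∫⁻ u, h₁ u) * (∫⁻ v, h₂ v)) := by
        refine lintegral_congr fun p => ?_
        rw [show (volume : Measure ((Fin 2 → ℝ) × (Fin 2 → ℝ))) = (volume : Measure (Fin 2 → ℝ)).prod volume from rfl,
          lintegral_prod_mul hh₁.aemeasurable hh₂.aemeasurable]

/-- ★ The restricted twin: for measurable `P ⊆ ℝ × ℝ` and ANY `Q`,
`∫⁻ (x,y) in {(x 0, y 0) ∈ P ∧ Q}, G (x 0, y 0) · (h₁ · h₂) ≤ ∫⁻ p in P, G p · ((∫⁻ h₁) · (∫⁻ h₂))`. [folklore] -/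
theorem setLIntegral_leaderPair_le_base (G : ℝ × ℝ → ℝ≥0∞) {h₁ h₂ : (Fin 2 → ℝ) → ℝ≥0∞} (hh₁ : Measurable h₁) (hh₂ : Measurable h₂)
    {P : Set (ℝ × ℝ)} (hP : MeasurableSet P) (Q : (Fin 3 → ℝ) × (Fin 3 → ℝ) → Prop) :
    ∫⁻ xy in {xy : (Fin 3 → ℝ) × (Fin 3 → ℝ) | (xy.1 0, xy.2 0) ∈ P ∧ Q xy}, G (xy.1 0, xy.2 0) * (h₁ (fun i : Fin 2 => xy.1 i.succ) * h₂ (fun i : Fin 2 => xy.2 i.succ)) ≤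
      ∫⁻ p in P, G p * ((∫⁻ u, h₁ u) * (∫⁻ v, h₂ v)) := by
  have hπ : Measurable fun xy : (Fin 3 → ℝ) × (Fin 3 → ℝ) => (xy.1 0, xy.2 0) :=
    ((measurable_pi_apply 0).comp measurable_fst).prodMk ((measurable_pi_apply 0).comp measurable_snd)
  have hS : MeasurableSet {xy : (Fin 3 → ℝ) × (Fin 3 → ℝ) | (xy.1 0, xy.2 0) ∈ P} := hπ hP
  -- drop `Q`, then indicator inside `G`
  calc ∫⁻ xy in {xy : (Fin 3 → ℝ) × (Fin 3 → ℝ) | (xy.1 0, xy.2 0) ∈ P ∧ Q xy}, G (xy.1 0, xy.2 0) * (h₁ (fun i : Fin 2 => xy.1 i.succ) * h₂ (fun i : Fin 2 => xy.2 i.succ))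
      ≤ ∫⁻ xy in {xy : (Fin 3 → ℝ) × (Fin 3 → ℝ) | (xy.1 0, xy.2 0) ∈ P}, G (xy.1 0, xy.2 0) * (h₁ (fun i : Fin 2 => xy.1 i.succ) * h₂ (fun i : Fin 2 => xy.2 i.succ)) :=
        lintegral_mono_set fun xy hxy => hxy.1
    _ = ∫⁻ xy : (Fin 3 → ℝ) × (Fin 3 → ℝ), P.indicator G (xy.1 0, xy.2 0) * (h₁ (fun i : Fin 2 => xy.1 i.succ) * h₂ (fun i : Fin 2 => xy.2 i.succ)) := by
        rw [← lintegral_indicator hS]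
        refine lintegral_congr fun xy => ?_
        by_cases h : (xy.1 0, xy.2 0) ∈ P
        · rw [Set.indicator_of_mem (show xy ∈ {xy : (Fin 3 → ℝ) × (Fin 3 → ℝ) | (xy.1 0, xy.2 0) ∈ P} from h), Set.indicator_of_mem h]
        · rw [Set.indicator_of_notMem (show xy ∉ {xy : (Fin 3 → ℝ) × (Fin 3 → ℝ) | (xy.1 0, xy.2 0) ∈ P} from h), Set.indicator_of_notMem h, zero_mul]
    _ ≤ ∫⁻ p : ℝ × ℝ, P.indicator G p * ((∫⁻ u, h₁ u) * (∫⁻ v, h₂ v)) := lintegral_leaderPair_le_base (P.indicator G) hh₁ hh₂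
    _ = ∫⁻ p in P, G p * ((∫⁻ u, h₁ u) * (∫⁻ v, h₂ v)) := by
        rw [← lintegral_indicator hP]
        refine lintegral_congr fun p => ?_
        by_cases h : p ∈ P
        · rw [Set.indicator_of_mem h, Set.indicator_of_mem h]
        · rw [Set.indicator_of_notMem h, Set.indicator_of_notMem h, zero_mul]

end Summit.QuantumFields.YangMills.Theorems.SwapVirialDeficit.SectorLaplace

end
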